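import Literature.NumberTheory.ComplexMultiplication.CMTypeGaloisClassesSingle
import Literature.NumberTheory.ComplexMultiplication.SexticCMFieldPrimitive
import HarnessLib

/-!
# DIS 2022 Prop. 12 up to Galois equivalence: a sextic CM field whose Galois closure has degree `24` or `48`
# (`Gal(Kᶜ/ℚ) = C₂³ ⋊ C₃`, `C₂³ ⋊ S₃`) has ONE Galois class of CM types — the pair flips give Dodson's `v = n = 3`

Layer `Literature/NumberTheory/ComplexMultiplication`, namespace `Literature.NumberTheory.ComplexMultiplication` (lane
`lit-hodgefound`, Track 2 foundations, Layer A3; seat `lit-hodgefound-p11`, generation 24, row g24-#11).  Sequel of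
`CMTypeGaloisClassesSingle` (g24-#9: `[L : K₀ᶜ] = 2^g ⟹` one Galois class, and its consequences) on the tree's sextic
group theory `SexticCMTypesB3` / `SexticCMTypesB3Abstract` (the model `W(B₃) = C_{𝔖₆}(cc)`; `flips_mem`: a subgroup
`𝒢 ≤ W` of order `24` or `48` containing `cc` contains the three sign changes; `exists_equiv_cc`, `toPerm6`),
`SexticCMFieldPrimitive` (the field-level setting), `ReflexDegreeImprimitivity` (`Gal(L/K₀ᶜ) = {g | ∀ φ, g ∘ φ ∈ {φ, φ̄}}`)
and `ReflexDegreeMaximal` (`card_pairKernel_eq_two_pow_of_flips`).  THEOREMS ONLY; no definition, no named fact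
(D-0026).

THE PRINT.  B. Dina, S. Ionica, J. Sijsling (2022), §1.2 Prop. 12: «Let `K` be a sextic CM field with Galois group
`C₂³ ⋊ C₃` or `C₂³ ⋊ S₃`. Then `K` admits `4` CM types up to equivalence, which are all primitive. Up to Galois
equivalence, `K` admits `1` CM type.» (proof: «using the element `σ = ((0,0,0), (1 2 3))` … », i.e. the sign changes and
the rotation act transitively on the `8` types).  B. Dodson (1984), §5.1.2 Theorem (the ρ-structures for `n = 3`:
`(ℤ₂)ᵛ ⋊ G₀` with `v ∈ {1, 3}`, `G₀ ∈ {ℤ₃, 𝔖₃}`; orders `24`, `48` are `v = 3`) and §5.1.3 Proposition 1 («the case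
`v = n` gives a single orbit», «`2³ = 8` holds for both `G = (ℤ₂)³ ⋊ G₀`»).  Here the Galois group is identified by
the DEGREE of the Galois closure (`24` or `48`), as in the tree's `SexticCMFieldPrimitive`.

WHAT IS PROVED.
* §1 (group level) **`SexticB3.exists_pairFlip_of_card_of_central_involution`**: a faithful `G` of order `24` or `48`
  on six points with a central fixed-point-free involution `c` contains, for every point `x`, a PAIR FLIP at `x`
  (exchanging `x, c•x`, fixing the rest) — `flips_mem` pulled back through `toPerm6`.
* §2 (`K` sextic CM, `L` a normal closure with `[L : ℚ] ∈ {24, 48}`):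
  **`finrank_normalClosure_maximalRealSubfield_eq_eight`** (`[L : K₀ᶜ] = 8`, Dodson's `v = 3`);
  **`card_cmTypeGaloisClasses_eq_one_of_sextic`** (ONE Galois class — DIS Prop. 12), `cmTypeGaloisSetoid_r_of_sextic`,
  `finrank_traceField_eq_eight_of_sextic` (every reflex degree is `8`), `isPrimitive_of_sextic_complex` («all
  primitive», complex form), `isNondegenerate_of_sextic`, `SiegelCMPoint.IsCMPointOf.isSimple_of_sextic` (every CM
  point of `K` on `𝔥₃` has a simple torus), and the pair of counts
  `card_classes_eq_four_and_card_cmTypeGaloisClasses_eq_one_of_sextic` («`4` up to equivalence … `1` up to Galois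
  equivalence», the former from g24-#1 for `K` not Galois).

## References

* [DinaIonicaSijsling2022] B. Dina, S. Ionica, J. Sijsling, Math. Comp. 91 (2022), §1.2 Def. 8, Prop. 12.
* [Dodson1984] B. Dodson, Trans. AMS 283 (1984), §5.1.2 Theorem, §5.1.3 Proposition 1.
* [Ribet1980] K. A. Ribet, Mém. SMF (1980), §3 Cor. (3.6).
* [Shimura1998] G. Shimura (1998), §8.2 Prop. 26.

## Provenance

Lane `lit-hodgefound` (HOME `run/shared/lean/pub/lit-hodgefound/`), prover seat `lit-hodgefound-p11` (gen 24),
self-proposed row g24-#11 (INBOX claim 2026-08-27, l.40303).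
-/

set_option autoImplicit false

noncomputable section

open scoped Classical NumberField Pointwise
open NumberField Module IntermediateField

namespace Literature.NumberTheory.ComplexMultiplication

/-! ## §1 Group level: a transitive faithful `G` of order `24`/`48` on six points with a central fixed-point-free
involution `c` contains the three pair flips -/

section Abstract

open Equiv

variable {G : Type*} [Group G] {X : Type*} [Fintype X] [DecidableEq X] [MulAction G X] [FaithfulSMul G X]

/-- **Pair flips exist** (Dodson §5.1.2 for `n = 3`: the ρ-structures of order `24`, `48` are `(ℤ₂)³ ⋊ G₀`, so every
sign change lies in the group): for every point `x` some `φ ∈ G` exchanges `x` and `c • x` and fixes the other four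
points (the tree's `SexticB3.flips_mem` in the coordinates of `SexticB3.exists_equiv_cc`).
[cite: Dodson1984, §5.1.2 Theorem] -/
theorem SexticB3.exists_pairFlip_of_card_of_central_involution (hX : Fintype.card X = 6)
    (hcard : Nat.card G = 24 ∨ Nat.card G = 48) (c : G) (hcen : ∀ g : G, c * g = g * c) (hc2 : c * c = 1)
    (hfix : ∀ x : X, c • x ≠ x) (x : X) :
    ∃ φ : G, φ • x = c • x ∧ ∀ y : X, y ≠ x → y ≠ c • x → φ • y = y := by
  obtain ⟨e, he0, hce⟩ := SexticB3.exists_equiv_cc hX (MulAction.toPerm c)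
    (fun y => by rw [MulAction.toPerm_apply, MulAction.toPerm_apply, smul_smul, hc2, one_smul]) hfix x
  have hce' : ∀ y, e (c • y) = SexticB3.cc (e y) := fun y => hce y
  set 𝒢 : Subgroup (Perm (Fin 6)) := (SexticB3.toPerm6 (G := G) e).range with h𝒢
  have hW : 𝒢 ≤ SexticB3.W := SexticB3.range_toPerm6_le_W hcen hce'
  have hc𝒢 : SexticB3.cc ∈ 𝒢 := ⟨c, SexticB3.toPerm6_eq_cc hce'⟩
  have hcard𝒢 : Nat.card 𝒢 = 24 ∨ Nat.card 𝒢 = 48 := by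
    rw [h𝒢, ← Nat.card_congr (MonoidHom.ofInjective (SexticB3.toPerm6_injective (G := G) e)).toEquiv]
    exact hcard
  obtain ⟨hf0, -, -⟩ := SexticB3.flips_mem 𝒢 hW hc𝒢 hcard𝒢
  obtain ⟨φ, hφ⟩ := hf0
  have hact : ∀ y : X, e (φ • y) = SexticB3.f0 (e y) := fun y => by
    have h := congrArg (fun p : Perm (Fin 6) => p (e y)) hφ
    simp only [SexticB3.toPerm6_apply, Equiv.symm_apply_apply] at h
    exact h
  refine ⟨φ, e.injective ?_, fun y hy hy' => e.injective ?_⟩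
  · rw [hact, he0, hce', he0]
    decide
  · rw [hact]
    have h0 : e y ≠ 0 := fun h => hy (e.injective (h.trans he0.symm))
    have h3 : e y ≠ 3 := fun h => hy' (e.injective (by rw [h, hce', he0]; decide))
    change Equiv.swap (0 : Fin 6) 3 (e y) = e y
    exact Equiv.swap_apply_of_ne_of_ne h0 h3

end Abstract

/-! ## §2 Sextic CM fields with `[Kᶜ : ℚ] ∈ {24, 48}`: `v = 3`, one Galois class -/

section Sextic

open Literature.AlgebraicGeometry.Motives (CMType)

variable {K : Type} [Field K] [NumberField K] [IsCMField K]
variable {L : Type} [Field L] [NumberField L] [IsCMField L] [IsNormalClosure ℚ K L]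

/-- **`v = 3` for the two big sextic Galois groups**: if the Galois closure `L` of the sextic CM field `K` has degree
`24` or `48`, then `[L : K₀ᶜ] = 8 = 2³` — every sign change of the three conjugate pairs of embeddings is a Galois
automorphism (the pair flips generate all of `(ℤ₂)³`; tree `card_pairKernel_eq_two_pow_of_flips`).
[cite: Dodson1984, §5.1.2 Theorem and §5.1.3 Proposition 1] -/
theorem finrank_normalClosure_maximalRealSubfield_eq_eight (h6 : finrank ℚ K = 6)
    (hL : finrank ℚ L = 24 ∨ finrank ℚ L = 48) :
    finrank (normalClosure ℚ (maximalRealSubfield K) L) L = 8 := by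
  classical
  haveI : IsGalois ℚ L := isGalois_of_isNormalClosure (L := L) K
  haveI : Normal ℚ L := IsNormalClosure.normal (F := ℚ) (K := K) (L := L)
  obtain ⟨j⟩ : Nonempty (K →ₐ[ℚ] L) :=
    Fintype.card_pos_iff.1 (by rw [card_algHom_eq_finrank K]; exact Module.finrank_pos)
  obtain ⟨ι⟩ : Nonempty (L →+* ℂ) := inferInstance
  obtain ⟨Φ₀⟩ : Nonempty (CMType K) := CMTypeCount.nonempty_cmType_iff_isTotallyComplex.2 inferInstance
  have hW := isCMTypeWith_conjGal_algValuedIn ι Φ₀ (L := L)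
  have hX : Fintype.card (K →ₐ[ℚ] L) = 6 := by rw [card_algHom_eq_finrank K, h6]
  have hcard : Nat.card (L ≃ₐ[ℚ] L) = 24 ∨ Nat.card (L ≃ₐ[ℚ] L) = 48 := by rwa [IsGalois.card_aut_eq_finrank]
  have hflip := SexticB3.exists_pairFlip_of_card_of_central_involution hX hcard (conjGal : L ≃ₐ[ℚ] L)
    conjGal_central conjGal_mul_conjGal conjGal_smul_ne
  have hV := hW.card_pairKernel_eq_two_pow_of_flips
    (V := (normalClosure ℚ (maximalRealSubfield K) L).fixingSubgroup)
    (mem_fixingSubgroup_normalClosure_maximalRealSubfield_iff j) hflip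
  rw [IsGalois.card_fixingSubgroup_eq_finrank, Nat.card_eq_fintype_card, hX] at hV
  exact hV

/-- **DIS PROP. 12, Galois form: «Let `K` be a sextic CM field with Galois group `C₂³ ⋊ C₃` or `C₂³ ⋊ S₃` … Up to
Galois equivalence, `K` admits `1` CM type»** — for a sextic CM field whose Galois closure has degree `24` or `48`
any two CM types are Galois equivalent (Dodson's case `v = n`, g24-#9
`card_cmTypeGaloisClasses_eq_one_of_finrank_normalClosure_eq`). [cite: DinaIonicaSijsling2022, §1.2 Prop. 12]
[cite: Dodson1984, §5.1.3 Proposition 1] -/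
theorem card_cmTypeGaloisClasses_eq_one_of_sextic (h6 : finrank ℚ K = 6) (hL : finrank ℚ L = 24 ∨ finrank ℚ L = 48) :
    Nat.card (Quotient (cmTypeGaloisSetoid K)) = 1 := by
  obtain ⟨j⟩ : Nonempty (K →ₐ[ℚ] L) :=
    Fintype.card_pos_iff.1 (by rw [card_algHom_eq_finrank K]; exact Module.finrank_pos)
  exact card_cmTypeGaloisClasses_eq_one_of_finrank_normalClosure_eq j
    (by rw [finrank_normalClosure_maximalRealSubfield_eq_eight h6 hL, h6]; norm_num)

/-- … any two CM types of such a field are Galois equivalent. [cite: DinaIonicaSijsling2022, §1.2 Prop. 12] -/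
theorem cmTypeGaloisSetoid_r_of_sextic (h6 : finrank ℚ K = 6) (hL : finrank ℚ L = 24 ∨ finrank ℚ L = 48)
    (Φ Ψ : CMType K) : (cmTypeGaloisSetoid K).r Φ Ψ :=
  card_cmTypeGaloisClasses_eq_one_iff.1 (card_cmTypeGaloisClasses_eq_one_of_sextic (L := L) h6 hL) Φ Ψ

/-- … every CM type has the maximal reflex degree `[K* : ℚ] = 8` (Dodson §5.1.3 «`2³ = 8` holds for both
`G = (ℤ₂)³ ⋊ G₀`»). [cite: Dodson1984, §5.1.3 Proposition 1] [cite: DinaIonicaSijsling2022, §1.2 Prop. 12] -/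
theorem finrank_traceField_eq_eight_of_sextic (h6 : finrank ℚ K = 6) (hL : finrank ℚ L = 24 ∨ finrank ℚ L = 48)
    (Φ : CMType K) : finrank ℚ (traceField Φ) = 8 := by
  have h := card_cmTypeGaloisClasses_eq_one_iff_forall.1 (card_cmTypeGaloisClasses_eq_one_of_sextic (L := L) h6 hL) Φ
  rw [h6] at h
  exact h

/-- … every CM type is primitive («which are all primitive»; complex form of the tree's `isPrimitive_of_sextic_cm`).
[cite: DinaIonicaSijsling2022, §1.2 Prop. 12] [cite: Shimura1998, §8.2 Prop. 26] -/
theorem isPrimitive_of_sextic_complex (h6 : finrank ℚ K = 6) (hL : finrank ℚ L = 24 ∨ finrank ℚ L = 48)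
    (Φ : CMType K) (φ₀ : K →+* ℂ) : IsPrimitive (ℂ ≃+* ℂ) Φ.1 φ₀ :=
  isPrimitive_of_card_cmTypeGaloisClasses_eq_one (card_cmTypeGaloisClasses_eq_one_of_sextic (L := L) h6 hL) Φ φ₀

/-- … every CM type is nondegenerate. [cite: Dodson1984, §5.1.3 Proposition 1] [cite: Ribet1980, §3 Cor. (3.6)] -/
theorem isNondegenerate_of_sextic (h6 : finrank ℚ K = 6) (hL : finrank ℚ L = 24 ∨ finrank ℚ L = 48)
    (Φ : CMType K) : Literature.AlgebraicGeometry.Pohlmann1968.IsNondegenerate Φ :=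
  isNondegenerate_of_card_cmTypeGaloisClasses_eq_one (card_cmTypeGaloisClasses_eq_one_of_sextic (L := L) h6 hL) Φ

open Literature.NumberTheory.Automorphic (siegelUpperHalfSpace)
open Literature.AlgebraicGeometry.ModuliOfAbelianVarieties.SiegelModuli (prinPeriod)
open Literature.Geometry.Kaehler.ComplexTorus (IsIsogenous IsSimple)

/-- … and every CM point of `K` on `𝔥₃` has a simple torus. [cite: DinaIonicaSijsling2022, §1.2 Prop. 12]
[cite: Shimura1998, §8.2 Prop. 26] -/
theorem SiegelCMPoint.IsCMPointOf.isSimple_of_sextic (h6 : finrank ℚ K = 6)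
    (hL : finrank ℚ L = 24 ∨ finrank ℚ L = 48) {Z : siegelUpperHalfSpace 3}
    {h : K →ₐ[ℚ] Matrix (Fin 3 ⊕ Fin 3) (Fin 3 ⊕ Fin 3) ℚ} (hZ : SiegelCMPoint.IsCMPointOf h Z) :
    IsSimple (prinPeriod Z) :=
  hZ.isSimple_of_card_cmTypeGaloisClasses_eq_one (h6.trans (by norm_num))
    (card_cmTypeGaloisClasses_eq_one_of_sextic (L := L) h6 hL)

/-- **DIS Prop. 12, both counts**: such a field, not being Galois over `ℚ`, has `4` Streng classes (g24-#1
`card_classes_eq_four_of_finrank_eq_six_of_not_isGalois`: `|Aut K| = 2`) but only `1` Galois class.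
[cite: DinaIonicaSijsling2022, §1.2 Prop. 12] -/
theorem card_classes_eq_four_and_card_cmTypeGaloisClasses_eq_one_of_sextic (h6 : finrank ℚ K = 6)
    (hL : finrank ℚ L = 24 ∨ finrank ℚ L = 48) (hKG : ¬ IsGalois ℚ K) :
    Nat.card (Quotient (cmTypeEquivSetoid K)) = 4 ∧ Nat.card (Quotient (cmTypeGaloisSetoid K)) = 1 :=
  ⟨card_classes_eq_four_of_finrank_eq_six_of_not_isGalois h6 hKG,
    card_cmTypeGaloisClasses_eq_one_of_sextic (L := L) h6 hL⟩

end Sextic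

end Literature.NumberTheory.ComplexMultiplication
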